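import Literature.MathematicalPhysics.QuantumFieldTheory.Balaban1983to89.B9Thm37GpTorusRegularFinal
import Literature.MathematicalPhysics.QuantumFieldTheory.Balaban1983to89.B9Thm39CinvAtCoverLarge

/-!
# `Balaban1983to89.B9Thm37GpAtCoverLarge` — [Balaban1985BackgroundPropagators] THEOREM 3.7 pp. 409–410 ⇒ THEOREM 3.1 (3.42) p. 397 FOR `G′(U)`, «FOR M
# SUFFICIENTLY LARGE» IN FULL: M5.5's consumer-facing `eBlock_kernelFamilySInv_Gp_of_localInverse` for EVERY member of the k-level V1 family above ONE
# threshold, with [4] Lemma 2.1, (2.63) and the two located smallness conditions DISCHARGED and the (3.42) constant made MEMBER-INDEPENDENT; and the knit with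
# M5.6 FILE 13: THEOREMS 3.7 + 3.9 ⇒ THEOREM 3.2 (3.48) p. 398 for `C(U) = (Q′G′²Q′*)⁻¹(U)` from Corollary 3.6's cube data, uniformly (cell `lit-balaban`,
# G-B9-LETTERS modules M5.5 FILE 7 ∕ M5.6 FILE 15, seat p21 gen 33)

statement-level skeleton of published theorems with citation tags; proofs where landed; nothing here is a claim about the Yang–Mills mass gap

CITATION HEADER (lean-in-tree rule).  B9 = T. Bałaban, *Propagators for lattice gauge theories in a background field*, Commun. Math. Phys. **99** (1985)
389–434: p. 408 «We have Σ_{□∈𝒟} h²_□ = 1»; p. 409 (3.87) «G′₀ = Σ_{□∈𝒟} h_□G′_□h_□», (3.88) «Δ′_aG′₀ = I − Σ_□K(h_□)G′_□h_□ = I − R′», (3.89) («O(M⁻¹)»), (3.90)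
«G′ = G′₀(I − R′)⁻¹», Theorem 3.7 «For M sufficiently large»; p. 410 «This theorem follows simply from Corollary 3.6 holding for all G′_□, □ ∈ 𝒟, from the
bound (3.89) and Lemma 2.1», «Theorem 3.7 implies that all the inequalities (3.42)–(3.47) hold for G′, thus we have completed the proof of Theorem 3.1», «of
course with different constants» (p. 403), «a decay rate arbitrarily close» (p. 410); Thm 3.1 (3.42) p. 397; p. 413 Theorem 3.9 «For M sufficiently large … This
theorem implies Theorem 3.2»; Thm 3.2 (3.48) p. 398.  [4] = [Balaban1984PropagatorsII] Prop. 2.2 (2.65)–(2.67), Lemma 2.1 (2.59)–(2.61), (2.63) pp. 233–234.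
Rows B9.Thm3.7 × B9.Thm3.1 × B9.Thm3.9 × B9.Thm3.2 (cells only; no row head changes).

WHY THIS FILE.  M5.5 FILE 6 (`B9Thm37GpTorusRegularFinal.eBlock_kernelFamilySInv_Gp_of_localInverse`) concludes, member by member,
`EBlock (kernelFamilySInv i B cfg G′ par) Bc_i ((1−2α)δ₀) U₁` with a constant `Bc_i` that DEPENDS ON THE MEMBER (through `M_h`, and through the two
`(1 − O(M⁻¹)c₁)⁻¹` factors of the located smallness conditions `hsmall`, `hsmallV`) and with [4] Lemma 2.1 ∕ (2.63) displayed.  Every consumer quantifying over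
the family — first of all M5.6 FILE 13 `B9Thm39CinvAtCoverLarge.cinv_cover_large`, whose `EBlock` inputs carry ONE constant `B_G` for all members — needs the
uniform form.  THIS FILE gives it: above a threshold depending only on the constants, `O(M⁻¹)c₁ ≦ ½` in both smallness conditions (print's «For M sufficiently
large»), so `(1 − …)⁻¹ ≦ 2`, every `M_h`-dependent piece of `Bc_i` is bounded by its value at `M_h = 1`, and `EBlock` is monotone in its constant:
`EBlock (…G′…) K_G ((1−2α)δ₀) U₁` with ONE `K_G` (§2).  §3 feeds §2 (for `G′`) and the cube letters' Corollary-3.6 blocks themselves (for the `G′_□`, rate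
weakened to `(1−2α)δ₀`) to M5.6 FILE 13: Theorem 3.2 (3.48) for `C(U)` from the cube data, for every member above one threshold, member-independent constant.

WHAT IS PROVED (all `theorem`s, 0 `def`, 0 sorry, 0 new named facts).
* §1 arithmetic ∕ bookkeeping: `frac_le_two` (`x(1−q)⁻¹ ≦ 2X` for `0 ≦ x ≦ X`, `q ≦ ½`), `inv_small` (`K·m⁻¹ ≦ ½` once `2K ≦ m`), `member_constant_le` (M5.5's
  constant `Bc_i`, written in its atoms, is `≦ K_G` once `M_h ≧ 1`, `2·N·S·(θ₃₈₉∕L)·c₁ ≦ M_h`, `2·N·S·U₀·c₁ ≦ M_h`), `eBlock_mono'` (the (3.42) block on `geo9K` is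
  monotone in its constant and anti-monotone in its rate — all factors nonnegative, distances `≧ 0`), `geo9K_M_eq'` (`M = L·M_h`).
* §2 ★★★ `eBlock_Gp_large` — THEOREM 3.7 ⇒ (3.42)₁₋₄ FOR `G′(U)` UNIFORMLY: for `B₀, δ₀ ≧ 0`, `αδ₀ > 0`, `(1−2α)δ₀ ≧ 0`, a neighbour count `m_N` and
  the coordinate bound `M₂` THERE ARE `M_L` and `K_G ≧ 0` such that for EVERY member `i` with `M_L ≦ M_i` and every datum of M5.5 FILE 6 (the cube letters'
  Cor-3.6 blocks `hE` with `B₀, δ₀`, `G′Δ′_a = 1`, the two local-inverse properties, bi-contractive bond variables ∕ averaging transporters, `η = |c_f|⁻¹`,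
  the section `ιB`, the neighbourhoods `Tn`): `EBlock (kernelFamilySInv i B cfg G′ par) K_G ((1−2α)δ₀) U₁`.
* §3 ★★★ `cinv_large_of_localInverse` — THEOREMS 3.7 + 3.9 ⇒ THEOREM 3.2 (3.48) FOR `C(U) = (Q′G′²Q′*)⁻¹(U)` FROM THE CUBE DATA, UNIFORMLY (§2 ∘ M5.6 FILE 13
  with `B_G := max K_G B₀`, `δ_G := (1−2α)δ₀`): ∃ `M_L`, `K ≧ 0`, ∀ member above `M_L`, from M5.5's per-member data for `G′` and the `G′_□` plus M5.6's
  (`IsUnit (Q′G′²Q′*)(U)`, contractive `par`, the cube letters `C_□` with `hloc` and un-localized (3.48) blocks, the localized [2]-difference majorants):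
  `conj b ((η²η²)⁻¹•(Q′G′²Q′*)⁻¹(U)) ≺ K·ℓ(a)⁻⁴·e^{−(1−α′)ρδd(a,a′)}`.

HONEST SCOPE / NOT CLAIMED.  Composition of landed theorems (M5.5 FILE 6, M5.6 FILES 11 ∕ 13) with elementary arithmetic; M5.5's and M5.6's scopes: displayed
per member stay the cube letters `G′_□` with their Corollary-3.6 blocks over the invariant class and the local-inverse properties (M5.1 ∕ M5.2 ∕ M5.4), the cube
letters `C_□` (Cor. 3.6 for `(Q′G′²_□Q′*)⁻¹`, M5.2-E), the localized [2]-difference estimate (GAP G-B9-05 — NOT derived in the tree), `G′Δ′_a = 1` (M5.3),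
`IsUnit (Q′G′²Q′*)` (w1), the bond-variable ∕ transporter ∕ coordinate bounds and the neighbour count.  «M sufficiently large» is the existential `M_L` (door
construction + explicit size conditions; no numerical `M`).  Sup-entries (3.42)₁₋₄ and (3.48) only; finite 𝕋 members of the k-level V1 family; nothing continuum,
nothing about OS axioms or the mass gap; NOT summit progress.  RELATED, NOT DUPLICATED: `B9SectBGpTransferInY.eBlock_mono` (constant-only monotonicity inside the
Sect. B transfer cone — restated here with the rate, to keep this cone inside M5.5 ∕ M5.6), M5.5 FILE 6 and M5.6 FILE 13 (USED BY NAME).  Searched 2026-08-28: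
`lean search 'Thm37GpAtCoverLarge|eBlock_Gp_large|cinv_large_of_localInverse|member_constant_le' --decl` = ∅.
-/

noncomputable section

namespace Literature.MathematicalPhysics.QuantumFieldTheory.Balaban1983to89.B9Thm37GpAtCoverLarge

open Node00 B9CubeLettersInvReadings
open B6Geom246MultiLevelBox (blkOf)
open B6Cover236MultiLevelBlocks (cubes)
open B6Cover236MultiLevelTorusBlocks (hB cubeIndT)
open B6Partition118KLevelFineSizes (C1F C1F_nonneg)
open B6Partition118KLevelFineSecond (C2F C2F_nonneg)
open B6Partition118KLevelTorusBinders (sLipT sLipT_nonneg)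
open B6Ineq2142KLevelV1 (β)
open B6KLevelCensusIndexV1 (KIdx)
open B6RandomWalk (HasMajorant Ineq261 Ineq263)
open B9Thm34Ext (toB6)
open B9FromB6 (EBlock pref4_nonneg)
open B9GeoNormsKLevelV1 (geo9K geo9K_supNorm_nonneg)
open B9GeoLemma21KLevelV1 (one_le_Mh geo9K_dist_nonneg')
open B9Eq352DivFormLetters (conj)
open B9Thm37CubeCoverCommutators (cutMulY hTY KhY)
open B9Thm37CubeCoverCommutatorSizes (four_le_P')
open B9Thm37CommutatorBound389 (theta389 theta389_nonneg)
open B9Thm37GpTorusRegularFinal (eBlock_kernelFamilySInv_Gp_of_localInverse)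
open B9GeoInputsMultiRateKLevelV1 (geo_inputs3_geo9K)
open B9Thm39CinvAtCover (chiBigT DsepT)
open B9Thm39CinvAtCoverLarge (cinv_cover_large)

variable {d ℓ : ℕ} {hd : 1 ≤ d + 1} {hL : Odd (ℓ + 1) ∧ 1 < ℓ + 1} {b₀ b₁ : ℝ}
variable {𝔸 : Type} [NormedRing 𝔸] [NormedAlgebra ℂ 𝔸] [CompleteSpace 𝔸]
variable {ι : Type} [Fintype ι] [DecidableEq ι]

/-! ## §1 Arithmetic of «M sufficiently large» and bookkeeping -/

/-- `x(1 − q)⁻¹ ≦ 2X` for `0 ≦ x ≦ X` and `q ≦ ½`. [cite: Balaban1984PropagatorsII, (2.66) p.234 («M sufficiently large»), bookkeeping] -/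
theorem frac_le_two {x X q : ℝ} (hx0 : 0 ≤ x) (hx : x ≤ X) (hq : q ≤ 2⁻¹) : x * (1 - q)⁻¹ ≤ 2 * X := by
  have h1 : (2 : ℝ)⁻¹ ≤ 1 - q := by linarith
  have h2 : (1 - q)⁻¹ ≤ 2 := (inv_anti₀ (by norm_num) h1).trans_eq (inv_inv 2)
  have h3 : 0 ≤ (1 - q)⁻¹ := inv_nonneg.mpr (le_trans (by norm_num) h1)
  calc x * (1 - q)⁻¹ ≤ X * 2 := mul_le_mul hx h2 h3 (hx0.trans hx)
    _ = 2 * X := mul_comm _ _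

/-- an `O(M⁻¹)` quantity against the threshold `2K ≦ m`: `K·m⁻¹ ≦ ½`. [cite: Balaban1985BackgroundPropagators, (3.89) p.409 («O(M⁻¹)»), bookkeeping] -/
theorem inv_small {K m : ℝ} (hm : 0 < m) (hT : 2 * K ≤ m) : K * m⁻¹ ≤ 2⁻¹ := by
  rw [← div_eq_mul_inv, div_le_iff₀ hm]
  linarith

/-- **M5.5 FILE 6's (3.42) CONSTANT IS BOUNDED BY A MEMBER-INDEPENDENT ONE ABOVE THE THRESHOLDS**, in its atoms (`S = M₂Σ‖b_j‖`, `N = 3·5^{d+1}`, `c = c₁(d′,δ₀,α)`,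
`θ = θ₃₈₉`, `L`, `D = d+1`, `m = M_h ≧ 1`, `e = e^{δ₀}`, `C₁ = C1F`, `C₂ = C2F`, `s_T`; the expression is M5.5 FILE 6's, verbatim in these atoms): once `2NS(θ/L)c ≦ m`
and `2NSU₀c ≦ m` both located smallness quantities are `≦ ½`, the four `(1 − …)⁻¹` are `≦ 2`, and every `m`-dependent size is at most its `m = 1` value.
[cite: Balaban1985BackgroundPropagators, Thm 3.7 p.409 («For M sufficiently large»), (3.89) p.409; Balaban1984PropagatorsII, (2.66) p.234] -/
theorem member_constant_le {S N c B₀ C₁ C₂ sT e mN θ L D m : ℝ}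
    (hS : 0 ≤ S) (hN : 0 ≤ N) (hc : 0 ≤ c) (hB₀ : 0 ≤ B₀) (hC₁ : 0 ≤ C₁) (hC₂ : 0 ≤ C₂) (he : 0 ≤ e) (hmN : 0 ≤ mN)
    (hθ : 0 ≤ θ) (hL0 : 0 < L) (hD : 0 ≤ D) (hm1 : 1 ≤ m)
    (hTq : 2 * (N * (S * (θ / L)) * c) ≤ m)
    (hTqV : 2 * (N * (S * ((B₀ * (D * ((1 + mN * e) * (5 / 8 * C₁) + mN * e * ((5 / 8) ^ 2 * C₂)) + L ^ 4 * (sT / L))) * L ^ 4)) * c) ≤ m) :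
    S * (N * (S * B₀) * c * (1 - N * (S * (θ / (L * m))) * c)⁻¹ + N * (S * (B₀ * (1 + 5 / 8 * C₁ / m))) * c * (1 - N * (S * (θ / (L * m))) * c)⁻¹ + N
      * (S * (B₀ * (1 + mN * e * (5 / 8 * C₁ / m)))) * c * (1 - N * (S * ((B₀ * (D * ((1 + mN * e) * (5 / 8 * C₁ / m) + mN * e * ((5 / 8) ^ 2 * C₂ / m ^ 2))
      + L ^ 4 * (sT / (L * m)))) * L ^ 4)) * c)⁻¹ + N * (S * (B₀ + θ / (L * m))) * c * (1 - N * (S * (θ / (L * m))) * c)⁻¹)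
      ≤ S * (2 * (N * (S * B₀) * c) + 2 * (N * (S * (B₀ * (1 + 5 / 8 * C₁))) * c) + 2 * (N * (S * (B₀ * (1 + mN * e * (5 / 8 * C₁)))) * c) + 2 * (N * (S
        * (B₀ + θ / L)) * c)) := by
  have hm0 : 0 < m := one_pos.trans_le hm1
  have hL4 : 0 ≤ L ^ 4 := pow_nonneg hL0.le 4
  have hminv : m⁻¹ ≤ 1 := inv_le_one_of_one_le₀ hm1
  -- the commutator size `θ/(L·m) = (θ/L)·m⁻¹ ≦ θ/L`
  have ht : θ / (L * m) = θ / L * m⁻¹ := by ring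
  have hθL : 0 ≤ θ / L := div_nonneg hθ hL0.le
  have htle : θ / (L * m) ≤ θ / L := by rw [ht]; exact mul_le_of_le_one_right hθL hminv
  -- the first smallness quantity `q ≦ ½`
  have hq : N * (S * (θ / (L * m))) * c ≤ 2⁻¹ := by
    rw [ht, show N * (S * (θ / L * m⁻¹)) * c = N * (S * (θ / L)) * c * m⁻¹ by ring]
    exact inv_small hm0 hTq
  -- the second smallness quantity `q_V ≦ ½`
  have hC2m : (5 / 8) ^ 2 * C₂ / m ^ 2 ≤ (5 / 8) ^ 2 * C₂ / m := div_le_div_of_nonneg_left (by positivity) hm0 (by nlinarith)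
  have h1 : (1 + mN * e) * (5 / 8 * C₁ / m) + mN * e * ((5 / 8) ^ 2 * C₂ / m ^ 2)
      ≤ (1 + mN * e) * (5 / 8 * C₁ / m) + mN * e * ((5 / 8) ^ 2 * C₂ / m) :=
    add_le_add le_rfl (mul_le_mul_of_nonneg_left hC2m (mul_nonneg hmN he))
  have hu : ((B₀ * (D * ((1 + mN * e) * (5 / 8 * C₁ / m) + mN * e * ((5 / 8) ^ 2 * C₂ / m ^ 2)) + L ^ 4 * (sT / (L * m)))) * L ^ 4)
      ≤ ((B₀ * (D * ((1 + mN * e) * (5 / 8 * C₁) + mN * e * ((5 / 8) ^ 2 * C₂)) + L ^ 4 * (sT / L))) * L ^ 4) * m⁻¹ :=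
    (mul_le_mul_of_nonneg_right (mul_le_mul_of_nonneg_left (add_le_add (mul_le_mul_of_nonneg_left h1 hD) le_rfl) hB₀) hL4).trans
      (le_of_eq (by ring))
  have hqV : N * (S * ((B₀ * (D * ((1 + mN * e) * (5 / 8 * C₁ / m) + mN * e * ((5 / 8) ^ 2 * C₂ / m ^ 2)) + L ^ 4 * (sT / (L * m)))) * L ^ 4)) * c
      ≤ 2⁻¹ := by
    refine le_trans (mul_le_mul_of_nonneg_right (mul_le_mul_of_nonneg_left (mul_le_mul_of_nonneg_left hu hS) hN) hc) ?_
    rw [show N * (S * (((B₀ * (D * ((1 + mN * e) * (5 / 8 * C₁) + mN * e * ((5 / 8) ^ 2 * C₂)) + L ^ 4 * (sT / L))) * L ^ 4) * m⁻¹)) * c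
        = N * (S * ((B₀ * (D * ((1 + mN * e) * (5 / 8 * C₁) + mN * e * ((5 / 8) ^ 2 * C₂)) + L ^ 4 * (sT / L))) * L ^ 4)) * c * m⁻¹ by ring]
    exact inv_small hm0 hTqV
  -- the `m`-dependent sizes at most their `m = 1` values
  have hC1m : 5 / 8 * C₁ / m ≤ 5 / 8 * C₁ := div_le_self (by positivity) hm1
  have hx1 : 0 ≤ N * (S * B₀) * c := by positivity
  have hx2 : 0 ≤ N * (S * (B₀ * (1 + 5 / 8 * C₁ / m))) * c := by positivity
  have hx2' : N * (S * (B₀ * (1 + 5 / 8 * C₁ / m))) * c ≤ N * (S * (B₀ * (1 + 5 / 8 * C₁))) * c :=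
    mul_le_mul_of_nonneg_right (mul_le_mul_of_nonneg_left (mul_le_mul_of_nonneg_left
      (mul_le_mul_of_nonneg_left (add_le_add le_rfl hC1m) hB₀) hS) hN) hc
  have hx3 : 0 ≤ N * (S * (B₀ * (1 + mN * e * (5 / 8 * C₁ / m)))) * c := by positivity
  have hx3' : N * (S * (B₀ * (1 + mN * e * (5 / 8 * C₁ / m)))) * c ≤ N * (S * (B₀ * (1 + mN * e * (5 / 8 * C₁)))) * c :=
    mul_le_mul_of_nonneg_right (mul_le_mul_of_nonneg_left (mul_le_mul_of_nonneg_left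
      (mul_le_mul_of_nonneg_left (add_le_add le_rfl (mul_le_mul_of_nonneg_left hC1m (mul_nonneg hmN he))) hB₀) hS) hN) hc
  have hx4 : 0 ≤ N * (S * (B₀ + θ / (L * m))) * c := by positivity
  have hx4' : N * (S * (B₀ + θ / (L * m))) * c ≤ N * (S * (B₀ + θ / L)) * c :=
    mul_le_mul_of_nonneg_right (mul_le_mul_of_nonneg_left (mul_le_mul_of_nonneg_left (add_le_add le_rfl htle) hS) hN) hc
  exact mul_le_mul_of_nonneg_left (add_le_add (add_le_add (add_le_add (frac_le_two hx1 le_rfl hq) (frac_le_two hx2 hx2' hq))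
    (frac_le_two hx3 hx3' hqV)) (frac_le_two hx4 hx4' hq)) hS

variable (i : KIdx d ℓ hd hL b₀ b₁)

omit [Fintype ι] [DecidableEq ι] in
/-- **THE (3.42) BLOCK ON `geo9K` IS MONOTONE IN ITS CONSTANT AND ANTI-MONOTONE IN ITS RATE** (every factor of the bound is nonnegative, distances are `≧ 0`; p. 403
«of course with different constants», p. 410 «a decay rate arbitrarily close»). [cite: Balaban1985BackgroundPropagators, (3.42) p.397, bookkeeping] -/
theorem eBlock_mono' {B : B9.Backgrounds} (K : B9.KernelFamily (geo9K i) B) {B₀ B₀' δ δ' : ℝ} {U : B.Cfg}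
    (hle : B₀ ≤ B₀') (hδ : δ' ≤ δ) (h0' : 0 ≤ B₀') (h : EBlock K B₀ δ U) : EBlock K B₀' δ' U := by
  intro n lam y y' hs
  refine (h n lam y y' hs).trans ?_
  have h1 : 0 ≤ B9.pref4 ((geo9K i).len y) n := pref4_nonneg (B6KLevelCensusIndexV1.len_pos i y).le n
  have h2 := geo9K_supNorm_nonneg i lam
  have hdist := geo9K_dist_nonneg' i y y'
  have h3 : Real.exp (-(δ * (geo9K i).dist y y')) ≤ Real.exp (-(δ' * (geo9K i).dist y y')) :=
    Real.exp_le_exp.mpr (by nlinarith [mul_le_mul_of_nonneg_right hδ hdist])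
  calc B₀ * B9.pref4 ((geo9K i).len y) n * Real.exp (-(δ * (geo9K i).dist y y')) * (geo9K i).supNorm lam
      ≤ B₀' * B9.pref4 ((geo9K i).len y) n * Real.exp (-(δ * (geo9K i).dist y y')) * (geo9K i).supNorm lam :=
        mul_le_mul_of_nonneg_right (mul_le_mul_of_nonneg_right (mul_le_mul_of_nonneg_right hle h1) (Real.exp_pos _).le) h2
    _ ≤ B₀' * B9.pref4 ((geo9K i).len y) n * Real.exp (-(δ' * (geo9K i).dist y y')) * (geo9K i).supNorm lam :=
        mul_le_mul_of_nonneg_right (mul_le_mul_of_nonneg_left h3 (mul_nonneg h0' h1)) h2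

omit [Fintype ι] [DecidableEq ι] in
/-- `M = L·M_h` for the members of record (p. 408 «Each set B_j(Λ_j) is a union of big blocks, which are elementary cubes (cells) of the lattice MLʲηZ^d»,
«We assume that the size M of big blocks …»; in `geo9K`'s units `M = L·M_h`). [cite: Balaban1985BackgroundPropagators, p.408, bookkeeping] -/
theorem geo9K_M_eq' : (geo9K i).M = ((ℓ : ℝ) + 1) * (i.Mh : ℝ) := by
  show (((ℓ + 1 : ℕ) : ℝ)) * (i.Mh : ℝ) = ((ℓ : ℝ) + 1) * (i.Mh : ℝ)
  push_cast; ring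

/-! ## §2 ★★★ Theorem 3.7 ⇒ (3.42) for `G′(U)`, for every member above one threshold, member-independent constant -/

omit i in
/-- ★★★ **THEOREM 3.7 ⇒ THEOREM 3.1 (3.42)₁₋₄ FOR `G′(U)` FOR EVERY MEMBER ABOVE ONE THRESHOLD, WITH A MEMBER-INDEPENDENT CONSTANT AND NO LOCATED SMALLNESS** («For M
sufficiently large … Theorem 3.7 implies that all the inequalities (3.42)–(3.47) hold for G′»): for `B₀, δ₀ ≧ 0`, `αδ₀ > 0`, `(1−2α)δ₀ ≧ 0`, a neighbour
count `m_N` and the coordinate bound `M₂` of the real basis `b`, THERE ARE `M_L` and `K_G ≧ 0` such that for every member `i` with `M_L ≦ M_i`: from the cube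
letters' Corollary-3.6 blocks over the invariant class (`hE`, constants `B₀, δ₀`), `G′(U₁)·Δ′_a(U₁) = 1`, the two local-inverse properties at the cut-offs of record,
bi-contractive bond variables and averaging transporters, `η = |c_f|⁻¹`, a corner-free section `ιB` and neighbourhoods `Tn` of at most `m_N` index bonds, the reading
of `G′(U₁)` over the invariant class satisfies `EBlock (kernelFamilySInv i B cfg G′ par) K_G ((1−2α)δ₀) U₁` (M5.5 FILE 6 with [4] Lemma 2.1, (2.63) and the two
smallness conditions discharged by §1 and FILE 11). [cite: Balaban1985BackgroundPropagators, Thm 3.7 (3.87)–(3.90) pp.409–410 ⇒ Thm 3.1 (3.42) p.397, Cor. 3.6 p.408;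
Balaban1984PropagatorsII, Prop 2.2 (2.65)–(2.67), Lemma 2.1 (2.59)–(2.61), (2.63) pp.233–234] -/
theorem eBlock_Gp_large [∀ i' : KIdx d ℓ hd hL b₀ b₁, Fintype (geo9K i').Site] [∀ i' : KIdx d ℓ hd hL b₀ b₁, DecidableEq (geo9K i').Site]
    (Rr : KIdx d ℓ hd hL b₀ b₁ → ℝ) (Hp : KIdx d ℓ hd hL b₀ b₁ → Prop) (b : Module.Basis ι ℝ 𝔸)
    {M₂ : ℝ} (hM₂ : 0 ≤ M₂) (hrepr : ∀ (v : 𝔸) (j : ι), |b.repr v j| ≤ M₂ * ‖v‖)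
    {B₀ δ₀ α : ℝ} (hB₀ : 0 ≤ B₀) (hδ₀ : 0 ≤ δ₀) (hαδ : 0 < α * δ₀) (hαδ2 : 0 ≤ (1 - 2 * α) * δ₀) (mN : ℕ) :
    ∃ ML KG : ℝ, 0 ≤ KG ∧ ∀ i : KIdx d ℓ hd hL b₀ b₁, ML ≤ (geo9K i).M →
      ∀ {B : B9.Backgrounds} (cfg : B.Cfg → CfgY 𝔸 i) (parS : SiteParY 𝔸 i) {U₁ : B.Cfg} (ιB : BlkY i → IBondY i)
        (hι : ∀ s, β i.hN i.D i.hk (ιB s) = s) (hη : etaS i = |i.cf|⁻¹) (Gp : SiteOpY 𝔸 i) (Oc : ↥(cubes i.D.toDomains) → SiteOpY 𝔸 i)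
        (hinvC : Gp (cfg U₁) * deltaPrimeAY i parS (cfg U₁) = 1)
        (hloc : ∀ c, cutMulY (hTY i c) * deltaPrimeAY i parS (cfg U₁) * Oc c (cfg U₁) * cutMulY (hTY i c) = cutMulY (hTY i c) * cutMulY (hTY i c))
        (hlocT : ∀ c, cutMulY (hTY i c) * Oc c (cfg U₁) * deltaPrimeAY i parS (cfg U₁) * cutMulY (hTY i c) = cutMulY (hTY i c) * cutMulY (hTY i c))
        (hE : ∀ c, EBlock (kernelFamilySInv i B cfg (Oc c) parS) B₀ δ₀ U₁)
        (hVb : ∀ (μ : Fin (d + 1)) (x : SiteY i), ‖(UboxY i (cfg U₁) μ x : 𝔸)‖ ≤ 1 ∧ ‖(((UboxY i (cfg U₁) μ x)⁻¹ : 𝔸ˣ) : 𝔸)‖ ≤ 1)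
        (hTr : ∀ z w : SiteY i, ‖(avgTrY i parS (cfg U₁) z w : 𝔸)‖ ≤ 1 ∧ ‖(((avgTrY i parS (cfg U₁) z w)⁻¹ : 𝔸ˣ) : 𝔸)‖ ≤ 1)
        (Tn : IBondY i → Finset (IBondY i)) (hTn : ∀ a y' : IBondY i, (geo9K i).dist a y' ≤ 1 → a ∈ Tn y')
        (hnbr : ∀ y' : IBondY i, (Tn y').card ≤ mN),
        EBlock (kernelFamilySInv i B cfg Gp parS) KG ((1 - 2 * α) * δ₀) U₁ := by
  -- `αδ₀ > 0`, `(1−2α)δ₀ ≧ 0` force `δ₀ > 0` and `α ≦ ½ ≦ 1`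
  have hδpos : 0 < δ₀ := lt_of_le_of_ne hδ₀ (by rintro h; rw [← h, mul_zero] at hαδ; exact lt_irrefl _ hαδ)
  have hα1 : α ≤ 1 := by nlinarith [hαδ2, hδpos]
  -- [4] Lemma 2.1 and (2.63) at `(δ₀, α)` above one threshold (FILE 11, all three pairs equal), at an exponent `d'`
  obtain ⟨MLg, hgeo⟩ := geo_inputs3_geo9K Rr Hp hαδ hαδ hαδ hδ₀ hα1
  obtain ⟨d', hgeo'⟩ : ∃ d' : ℕ, ∀ i : KIdx d ℓ hd hL b₀ b₁, MLg ≤ (geo9K i).M →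
      Ineq261 d' (toB6 (geo9K i) (Rr i) (Hp i)) δ₀ α ∧ Ineq263 d' (toB6 (geo9K i) (Rr i) (Hp i)) δ₀ α :=
    ⟨_, fun i hM => by obtain ⟨-, -, -, -, -, -, h7, h8⟩ := hgeo i hM; exact ⟨h7, h8⟩⟩
  -- the member-independent atoms `S = M₂Σ‖b_j‖`, `c = c₁(d′, δ₀, α)`
  obtain ⟨S, hS⟩ : ∃ S : ℝ, S = M₂ * (∑ j, ‖b j‖) := ⟨_, rfl⟩
  obtain ⟨c, hc⟩ : ∃ c : ℝ, c = B6.c1 d' δ₀ α := ⟨_, rfl⟩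
  have hSb : 0 ≤ S := by rw [hS]; exact mul_nonneg hM₂ (Finset.sum_nonneg fun _ _ => norm_nonneg _)
  have hN0 : (0 : ℝ) ≤ 3 * 5 ^ (d + 1) := by positivity
  have hc0 : 0 ≤ c := by rw [hc]; exact B6RandomWalk.c1_nonneg _ _ _
  have hθ0 : 0 ≤ theta389 d ℓ B₀ δ₀ := theta389_nonneg d ℓ hB₀ δ₀
  have hC₁ := C1F_nonneg d ℓ
  have hC₂ := C2F_nonneg d ℓ
  have he : 0 ≤ Real.exp δ₀ := (Real.exp_pos δ₀).le
  have hmN : (0 : ℝ) ≤ mN := Nat.cast_nonneg mN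
  have hL0 : (0 : ℝ) < (ℓ : ℝ) + 1 := by positivity
  have hD0 : (0 : ℝ) ≤ (d : ℝ) + 1 := by positivity
  have hKG0 : 0 ≤ S * (2 * ((3 * 5 ^ (d + 1)) * (S * B₀) * c) + 2 * ((3 * 5 ^ (d + 1)) * (S * (B₀ * (1 + 5 / 8 * C1F d ℓ))) * c) + 2 * ((3 * 5 ^ (d + 1)) * (S * (B₀
      * (1 + (mN : ℝ) * Real.exp δ₀ * (5 / 8 * C1F d ℓ)))) * c) + 2 * ((3 * 5 ^ (d + 1)) * (S * (B₀ + theta389 d ℓ B₀ δ₀ / ((ℓ : ℝ) + 1))) * c)) := by positivity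
  refine ⟨max MLg (((ℓ : ℝ) + 1) * max (2 * ((3 * 5 ^ (d + 1)) * (S * (theta389 d ℓ B₀ δ₀ / ((ℓ : ℝ) + 1))) * c))
      (2 * ((3 * 5 ^ (d + 1)) * (S * ((B₀ * (((d : ℝ) + 1) * ((1 + (mN : ℝ) * Real.exp δ₀) * (5 / 8 * C1F d ℓ) + (mN : ℝ) * Real.exp δ₀ * ((5 / 8) ^ 2
        * C2F d ℓ)) + ((ℓ : ℝ) + 1) ^ 4 * (sLipT d ℓ / ((ℓ : ℝ) + 1)))) * ((ℓ : ℝ) + 1) ^ 4)) * c))),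
    S * (2 * ((3 * 5 ^ (d + 1)) * (S * B₀) * c) + 2 * ((3 * 5 ^ (d + 1)) * (S * (B₀ * (1 + 5 / 8 * C1F d ℓ))) * c) + 2 * ((3 * 5 ^ (d + 1)) * (S * (B₀
      * (1 + (mN : ℝ) * Real.exp δ₀ * (5 / 8 * C1F d ℓ)))) * c) + 2 * ((3 * 5 ^ (d + 1)) * (S * (B₀ + theta389 d ℓ B₀ δ₀ / ((ℓ : ℝ) + 1))) * c)), hKG0, fun i hM => ?_⟩
  intro B cfg parS U₁ ιB hι hη Gp Oc hinvC hloc hlocT hE hVb hTr Tn hTn hnbr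
  obtain ⟨h261, h263⟩ := hgeo' i ((le_max_left _ _).trans hM)
  -- the thresholds in terms of `M_h`
  have hm1 : (1 : ℝ) ≤ (i.Mh : ℝ) := by exact_mod_cast one_le_Mh i
  have hm0 : (0 : ℝ) < (i.Mh : ℝ) := one_pos.trans_le hm1
  have hMh : max (2 * ((3 * 5 ^ (d + 1)) * (S * (theta389 d ℓ B₀ δ₀ / ((ℓ : ℝ) + 1))) * c))
      (2 * ((3 * 5 ^ (d + 1)) * (S * ((B₀ * (((d : ℝ) + 1) * ((1 + (mN : ℝ) * Real.exp δ₀) * (5 / 8 * C1F d ℓ) + (mN : ℝ) * Real.exp δ₀ * ((5 / 8) ^ 2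
        * C2F d ℓ)) + ((ℓ : ℝ) + 1) ^ 4 * (sLipT d ℓ / ((ℓ : ℝ) + 1)))) * ((ℓ : ℝ) + 1) ^ 4)) * c))
      ≤ (i.Mh : ℝ) := by
    have h := (le_max_right _ _).trans hM
    rw [geo9K_M_eq' i] at h
    exact le_of_mul_le_mul_left h hL0
  have hTq := (le_max_left _ _).trans hMh
  have hTqV := (le_max_right _ _).trans hMh
  -- M5.5 FILE 6's constant at this member is `≦ K_G`
  have hle := member_constant_le hSb hN0 hc0 hB₀ hC₁ hC₂ he hmN hθ0 hL0 hD0 hm1 hTq hTqV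
  -- its located smallness conditions from the thresholds
  have hq : (3 * 5 ^ (d + 1)) * (S * (theta389 d ℓ B₀ δ₀ / (((ℓ : ℝ) + 1) * i.Mh))) * c < 1 := by
    have ht : theta389 d ℓ B₀ δ₀ / (((ℓ : ℝ) + 1) * i.Mh) = theta389 d ℓ B₀ δ₀ / ((ℓ : ℝ) + 1) * ((i.Mh : ℝ))⁻¹ := by
      rw [div_mul_eq_div_div, div_eq_mul_inv (theta389 d ℓ B₀ δ₀ / ((ℓ : ℝ) + 1))]
    rw [ht, show (3 * 5 ^ (d + 1)) * (S * (theta389 d ℓ B₀ δ₀ / ((ℓ : ℝ) + 1) * ((i.Mh : ℝ))⁻¹)) * c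
      = (3 * 5 ^ (d + 1)) * (S * (theta389 d ℓ B₀ δ₀ / ((ℓ : ℝ) + 1))) * c * ((i.Mh : ℝ))⁻¹ by ring]
    exact lt_of_le_of_lt (inv_small hm0 hTq) (by norm_num)
  have hqV : (3 * 5 ^ (d + 1)) * (S * ((B₀ * (((d : ℝ) + 1) * ((1 + (mN : ℝ) * Real.exp δ₀) * (5 / 8 * C1F d ℓ / i.Mh) + (mN : ℝ) * Real.exp δ₀ * ((5 / 8) ^ 2
      * C2F d ℓ / (i.Mh : ℝ) ^ 2)) + ((ℓ : ℝ) + 1) ^ 4 * (sLipT d ℓ / (((ℓ : ℝ) + 1) * i.Mh)))) * ((ℓ : ℝ) + 1) ^ 4)) * c < 1 := by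
    have hC2m : (5 / 8) ^ 2 * C2F d ℓ / (i.Mh : ℝ) ^ 2 ≤ (5 / 8) ^ 2 * C2F d ℓ / (i.Mh : ℝ) :=
      div_le_div_of_nonneg_left (by positivity) hm0 (by nlinarith)
    have h1 : (1 + (mN : ℝ) * Real.exp δ₀) * (5 / 8 * C1F d ℓ / i.Mh) + (mN : ℝ) * Real.exp δ₀ * ((5 / 8) ^ 2 * C2F d ℓ / (i.Mh : ℝ) ^ 2)
        ≤ (1 + (mN : ℝ) * Real.exp δ₀) * (5 / 8 * C1F d ℓ / i.Mh) + (mN : ℝ) * Real.exp δ₀ * ((5 / 8) ^ 2 * C2F d ℓ / (i.Mh : ℝ)) :=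
      add_le_add le_rfl (mul_le_mul_of_nonneg_left hC2m (mul_nonneg hmN he))
    have h2 : ((B₀ * (((d : ℝ) + 1) * ((1 + (mN : ℝ) * Real.exp δ₀) * (5 / 8 * C1F d ℓ / i.Mh) + (mN : ℝ) * Real.exp δ₀ * ((5 / 8) ^ 2 * C2F d ℓ / (i.Mh : ℝ) ^ 2))
        + ((ℓ : ℝ) + 1) ^ 4 * (sLipT d ℓ / (((ℓ : ℝ) + 1) * i.Mh)))) * ((ℓ : ℝ) + 1) ^ 4)
        ≤ ((B₀ * (((d : ℝ) + 1) * ((1 + (mN : ℝ) * Real.exp δ₀) * (5 / 8 * C1F d ℓ) + (mN : ℝ) * Real.exp δ₀ * ((5 / 8) ^ 2 * C2F d ℓ)) + ((ℓ : ℝ) + 1) ^ 4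
        * (sLipT d ℓ / ((ℓ : ℝ) + 1)))) * ((ℓ : ℝ) + 1) ^ 4) * ((i.Mh : ℝ))⁻¹ :=
      (mul_le_mul_of_nonneg_right (mul_le_mul_of_nonneg_left (add_le_add (mul_le_mul_of_nonneg_left h1 hD0) le_rfl) hB₀)
        (pow_nonneg hL0.le 4)).trans (le_of_eq (by rw [div_mul_eq_div_div]; ring))
    refine lt_of_le_of_lt (le_trans (mul_le_mul_of_nonneg_right (mul_le_mul_of_nonneg_left (mul_le_mul_of_nonneg_left h2 hSb) hN0) hc0) ?_)
      (by norm_num : (2 : ℝ)⁻¹ < 1)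
    rw [show (3 * 5 ^ (d + 1)) * (S * (((B₀ * (((d : ℝ) + 1) * ((1 + (mN : ℝ) * Real.exp δ₀) * (5 / 8 * C1F d ℓ) + (mN : ℝ) * Real.exp δ₀ * ((5 / 8) ^ 2 * C2F d ℓ))
        + ((ℓ : ℝ) + 1) ^ 4 * (sLipT d ℓ / ((ℓ : ℝ) + 1)))) * ((ℓ : ℝ) + 1) ^ 4) * ((i.Mh : ℝ))⁻¹)) * c
        = (3 * 5 ^ (d + 1)) * (S * ((B₀ * (((d : ℝ) + 1) * ((1 + (mN : ℝ) * Real.exp δ₀) * (5 / 8 * C1F d ℓ) + (mN : ℝ) * Real.exp δ₀ * ((5 / 8) ^ 2 * C2F d ℓ))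
          + ((ℓ : ℝ) + 1) ^ 4 * (sLipT d ℓ / ((ℓ : ℝ) + 1)))) * ((ℓ : ℝ) + 1) ^ 4)) * c * ((i.Mh : ℝ))⁻¹ by ring]
    exact inv_small hm0 hTqV
  rw [hS, hc] at hq hqV
  have h := eBlock_kernelFamilySInv_Gp_of_localInverse i b cfg parS (Rr := Rr i) (Hp := Hp i) ιB hι hM₂ hrepr hη Gp Oc hinvC hloc hlocT hB₀ hδ₀ hE
    hVb hTr Tn hTn hnbr d' hαδ.le hαδ2 h261 h263 hq hqV
  rw [← hS, ← hc] at h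
  exact eBlock_mono' i _ hle le_rfl hKG0 h

/-! ## §3 ★★★ The knit with M5.6 FILE 13: Theorems 3.7 + 3.9 ⇒ Theorem 3.2 (3.48) for `C(U)` from the cube data, uniformly -/

omit i in
/-- ★★★ **THEOREMS 3.7 + 3.9 ⇒ THEOREM 3.2 (3.48) FOR `C(U) = (Q′G′²Q′*)⁻¹(U)` FROM COROLLARY 3.6's CUBE DATA, FOR EVERY MEMBER ABOVE ONE THRESHOLD, MEMBER-INDEPENDENT
CONSTANT** (§2 for `G′` and the cube letters' own Corollary-3.6 blocks, rate weakened to `δ_G = (1−2α_E)δ_E`, constant `max K_G B_E`, fed to M5.6 FILE 13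
`cinv_cover_large`): for the cube letters' block constants `B_E, δ_E ≧ 0`, `α_Eδ_E > 0`, M5.6's rate data with `δ_G := (1−2α_E)δ_E` (`α_Gδ_G > 0`,
`0 < α₂ ≦ 1`, `(1−α_G)δ_G > 0`, `δ₀ > 0`, `0 < ρ < b`, `0 < α′ ≦ 1`, `α_st > 0`, `a_Lδ₀ ≦ (1−α₂)(1−α_G)δ_G`, `a_sep > 0`, `α_cδ₀ > 0`, the splits), constants `B₀, κ_D ≧ 0`,
a neighbour count and the coordinate bound, THERE ARE `M_L` and `K ≧ 0` such that for every member `i` with `M_L ≦ M_i`: from M5.5's data for `G′ = Gp` and the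
`G′_□ = Oc □` (`hη hinvC hloc5 hlocT hE hVb hTr Tn hTn hnbr`) and M5.6's (`IsUnit (XY i par G′ U₁)`, contractive `par`, the cube letters `C_□ = Cl □` with `hloc` and
un-localized (3.48) blocks `hC`, the localized [2]-difference majorants `hD` at the cover of record):
`conj b ((η²η²)⁻¹•(XinvY i par G′ U₁)) ≺ K·ℓ(a)⁻⁴·e^{−(1−α′)ρδ₀d(a,a′)}` on the block carrier `(t, j) ↦ ιB t`.
[cite: Balaban1985BackgroundPropagators, Thm 3.7 pp.409–410 + Thm 3.9 p.413 («This theorem implies Theorem 3.2») + Thm 3.1 (3.42) p.397 + Thm 3.2 (3.48) p.398 + Cor. 3.6 p.408;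
Balaban1984PropagatorsII, Lemma 2.1 p.234 + (2.83)–(2.87) pp.237–238] -/
theorem cinv_large_of_localInverse [∀ i' : KIdx d ℓ hd hL b₀ b₁, Fintype (geo9K i').Site] [∀ i' : KIdx d ℓ hd hL b₀ b₁, DecidableEq (geo9K i').Site]
    (Rr : KIdx d ℓ hd hL b₀ b₁ → ℝ) (Hp : KIdx d ℓ hd hL b₀ b₁ → Prop) (b : Module.Basis ι ℝ 𝔸)
    {M₂ : ℝ} (hM₂ : 0 ≤ M₂) (hrepr : ∀ (v : 𝔸) (j : ι), |b.repr v j| ≤ M₂ * ‖v‖)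
    {BE δE αE : ℝ} (hBE : 0 ≤ BE) (hδE : 0 ≤ δE) (hαEδ : 0 < αE * δE) (mN : ℕ)
    {αG α₂ δ₀ αst bb ρ α' aL aD αc asep B₀ κD : ℝ} (hαGδ : 0 < αG * ((1 - 2 * αE) * δE)) (hα₂0 : 0 < α₂) (hα₂1 : α₂ ≤ 1)
    (hδG : 0 < (1 - αG) * ((1 - 2 * αE) * δE)) (hδ₀ : 0 < δ₀) (hρ : 0 < ρ) (hρb : ρ < bb) (hα'0 : 0 < α') (hα'1 : α' ≤ 1) (hαst : 0 < αst)
    (hrate : aL * δ₀ ≤ (1 - α₂) * ((1 - αG) * ((1 - 2 * αE) * δE))) (hasep : 0 < asep) (hαc : 0 < αc * δ₀)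
    (hsplit₁ : αst + asep + ρ ≤ aL) (hsplit₂ : αst + ρ ≤ aD) (hsplit₃ : αst + αc + ρ ≤ aL) (hB₀ : 0 ≤ B₀) (hκD : 0 ≤ κD) :
    ∃ ML K : ℝ, 0 ≤ K ∧ ∀ i : KIdx d ℓ hd hL b₀ b₁, ML ≤ (geo9K i).M →
      ∀ {B : B9.Backgrounds} (cfg : B.Cfg → CfgY 𝔸 i) (parS : SiteParY 𝔸 i) {U₁ : B.Cfg} (ιB : BlkY i → IBondY i)
        (hι : ∀ s, β i.hN i.D i.hk (ιB s) = s) (hη : etaS i = |i.cf|⁻¹) (Gp : SiteOpY 𝔸 i) (Oc : ↥(cubes i.D.toDomains) → SiteOpY 𝔸 i)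
        (hinvC : Gp (cfg U₁) * deltaPrimeAY i parS (cfg U₁) = 1)
        (hloc5 : ∀ c, cutMulY (hTY i c) * deltaPrimeAY i parS (cfg U₁) * Oc c (cfg U₁) * cutMulY (hTY i c) = cutMulY (hTY i c) * cutMulY (hTY i c))
        (hlocT : ∀ c, cutMulY (hTY i c) * Oc c (cfg U₁) * deltaPrimeAY i parS (cfg U₁) * cutMulY (hTY i c) = cutMulY (hTY i c) * cutMulY (hTY i c))
        (hE : ∀ c, EBlock (kernelFamilySInv i B cfg (Oc c) parS) BE δE U₁)
        (hVb : ∀ (μ : Fin (d + 1)) (x : SiteY i), ‖(UboxY i (cfg U₁) μ x : 𝔸)‖ ≤ 1 ∧ ‖(((UboxY i (cfg U₁) μ x)⁻¹ : 𝔸ˣ) : 𝔸)‖ ≤ 1)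
        (hTr : ∀ z w : SiteY i, ‖(avgTrY i parS (cfg U₁) z w : 𝔸)‖ ≤ 1 ∧ ‖(((avgTrY i parS (cfg U₁) z w)⁻¹ : 𝔸ˣ) : 𝔸)‖ ≤ 1)
        (Tn : IBondY i → Finset (IBondY i)) (hTn : ∀ a y' : IBondY i, (geo9K i).dist a y' ≤ 1 → a ∈ Tn y')
        (hnbr : ∀ y' : IBondY i, (Tn y').card ≤ mN)
        (hunit : IsUnit (XY i parS Gp (cfg U₁)))
        (hpar : ∀ z w : SiteY i, ‖(parS (cfg U₁) z w : 𝔸)‖ ≤ 1 ∧ ‖(((parS (cfg U₁) z w)⁻¹ : 𝔸ˣ) : 𝔸)‖ ≤ 1)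
        (Cl : ↥(cubes i.D.toDomains) → Module.End ℝ (BlkY i → 𝔸))
        (hloc : ∀ c, (cutMulY (𝔸 := 𝔸) (hB i.D c)).restrictScalars ℝ *
          ((cutMulY (𝔸 := 𝔸) (chiBigT i c)).restrictScalars ℝ * (XY i parS (Oc c) (cfg U₁)).restrictScalars ℝ) * Cl c *
            (cutMulY (𝔸 := 𝔸) (hB i.D c)).restrictScalars ℝ =
          (cutMulY (𝔸 := 𝔸) (hB i.D c)).restrictScalars ℝ * (cutMulY (𝔸 := 𝔸) (hB i.D c)).restrictScalars ℝ)
        (hC : ∀ c, HasMajorant (g := toB6 (geo9K i) (Rr i) (Hp i)) (fun p : BlkY i × ι => ιB p.1) (conj b ((etaS i ^ 2 * etaS i ^ 2)⁻¹ • Cl c))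
          (fun a a' => B₀ * ((geo9K i).len a ^ 4)⁻¹ * Real.exp (-(bb * δ₀ * (geo9K i).dist a a'))))
        (hD : ∀ c, HasMajorant (g := toB6 (geo9K i) (Rr i) (Hp i)) (fun p : BlkY i × ι => ιB p.1)
          (conj b ((etaS i ^ 2 * etaS i ^ 2) • ((cutMulY (𝔸 := 𝔸) (chiBigT i c)).restrictScalars ℝ *
            ((XY i parS Gp (cfg U₁)).restrictScalars ℝ - (XY i parS (Oc c) (cfg U₁)).restrictScalars ℝ) *
            (cutMulY (𝔸 := 𝔸) (cubeIndT i.D (one_le_Mh i) (four_le_P' i) c)).restrictScalars ℝ)))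
          (fun a a'' => κD * Real.exp (-(2 * δ₀ * DsepT i)) * (geo9K i).len a ^ 4 * Real.exp (-(aD * δ₀ * (geo9K i).dist a a'')))),
        HasMajorant (g := toB6 (geo9K i) (Rr i) (Hp i)) (fun p : BlkY i × ι => ιB p.1)
          (conj b ((etaS i ^ 2 * etaS i ^ 2)⁻¹ • (XinvY i parS Gp (cfg U₁)).restrictScalars ℝ))
          (fun a a' => K * ((geo9K i).len a ^ 4)⁻¹ * Real.exp (-((1 - α') * (ρ * δ₀) * (geo9K i).dist a a'))) := by
  -- `(1−2α_E)δ_E = α_G·(1−2α_E)δ_E + (1−α_G)·(1−2α_E)δ_E > 0`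
  have hαE2 : 0 ≤ (1 - 2 * αE) * δE := (show 0 < (1 - 2 * αE) * δE by nlinarith [hαGδ, hδG]).le
  obtain ⟨ML₁, KG, hKG0, h55⟩ := eBlock_Gp_large (𝔸 := 𝔸) Rr Hp b hM₂ hrepr hBE hδE hαEδ hαE2 mN
  obtain ⟨ML₂, K, hK0, h13⟩ := cinv_cover_large (𝔸 := 𝔸) Rr Hp b hM₂ hrepr (BG := max KG BE) hαGδ hα₂0 hα₂1 hδG hδ₀ hρ hρb hα'0 hα'1 hαst hrate hasep
    hαc hsplit₁ hsplit₂ hsplit₃ (hKG0.trans (le_max_left _ _)) hB₀ hκD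
  refine ⟨max ML₁ ML₂, K, hK0, fun i hM => ?_⟩
  intro B cfg parS U₁ ιB hι hη Gp Oc hinvC hloc5 hlocT hE hVb hTr Tn hTn hnbr hunit hpar Cl hloc hC hD
  have hrateE : (1 - 2 * αE) * δE ≤ δE := by nlinarith [hαEδ.le]
  have hEG : EBlock (kernelFamilySInv i B cfg Gp parS) (max KG BE) ((1 - 2 * αE) * δE) U₁ :=
    eBlock_mono' i _ (le_max_left KG BE) le_rfl (hKG0.trans (le_max_left _ _))
      (h55 i ((le_max_left _ _).trans hM) cfg parS ιB hι hη Gp Oc hinvC hloc5 hlocT hE hVb hTr Tn hTn hnbr)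
  have hEc : ∀ c, EBlock (kernelFamilySInv i B cfg (Oc c) parS) (max KG BE) ((1 - 2 * αE) * δE) U₁ := fun c =>
    eBlock_mono' i _ (le_max_right KG BE) hrateE (hKG0.trans (le_max_left _ _)) (hE c)
  exact h13 i ((le_max_right _ _).trans hM) cfg Gp parS ιB Oc hEG hEc hι hunit hpar Cl hloc hC hD

end Literature.MathematicalPhysics.QuantumFieldTheory.Balaban1983to89.B9Thm37GpAtCoverLarge

end
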